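import Summits.Ventures.YMGap.RobustBall.StarChartKernel
import Summits.Ventures.YMGap.RobustBall.PeriodisedBox
import Summits.Ventures.YMGap.RobustBall.GibbsOfCylinderDLR
import Summits.Ventures.YMGap.RobustBall.PerturbedLimitStates
import Summits.Ventures.YMGap.RobustBall.PerturbedExistence
import HarnessLib

/-!
# Venture YMGap, track ROBUST-BALL — the VAN HOVE JOIN, step 3: the PERIODISED FAMILY of a `ℤ^d` member and
# the theorem «every infinite-volume limit state of its torus states is a DLR state of the member»

HONEST FRAMING. WHAT THIS IS: a venture file (cell `pub-ymgap`, track Y2 ROBUST-BALL, seat ds-3), lattice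
statements only. The track proves its MASS-GAP rows for the DLR states `perturbedGibbsMeasures ρ β W supp`
of a member `(W, supp)` of the `ℤ^d` ball (rb-p1's currency) and its AREA-LAW rows for the infinite-volume
limit states `perturbedLimitPoints β 𝓦` of the perturbed TORUS states of a family `𝓦` (rb-p2's currency);
for the Wilson action the tree identifies the two (`mem_ymGibbsMeasures_of_mem_infiniteVolumeLimitPoints_holds`),
for perturbed members nothing identified them. Here: the PERIODISED FAMILY `periodisedFamily W supp …` of a
member with gauge-invariant, measurable, bounded terms reading their own links puts on the torus of side
`L + 1` exactly the member's ACTIVE listed sets with all links based in the centred box `siteBox (L/2)` (on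
which `mod (L+1)` is injective), read through the periodic lift — ds-2's `chartMember` of the box family
(`PeriodisedBox.lean`). THEOREM `expectation_periodised_dlr` (fixed torus): once the box contains the active
family of `Λ` and the base sites of `Λ`, of the support of `F` and of the `W`- and plaquette collars of `Λ`,
the perturbed torus state gives the same expectation to `F ∘ torusLift` and to `(γ^{W}_Λ F) ∘ torusLift` —
torus DLR equations (`isGibbsMeasure_perturbedMeasure`), the kernels of the whole box member and of the
chart member of the active family of `Λ` coincide on `Λ.image (torusEdge L)` (the other box sets miss `Λ`;
`perturbedTorusSpec_eq_of_total_sub`), and ds-2's perturbed kernel transfer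
`integral_perturbedYM_torusLift_eq`. THEOREM ★ `mem_perturbedGibbsMeasures_of_mem_perturbedLimitPoints`:
for a member with continuous terms, local finiteness and range `R`, EVERY infinite-volume limit state of the
periodised family's torus states is a DLR state of the member's `ℤ^d` specification
(`perturbedLimitPoints β (periodisedFamily …) ⊆ perturbedGibbsMeasures ρ β W supp`) — Georgii's Thm. 4.17 route:
the identity above passes to the limit along the subsequence for bounded continuous cylinder observables
(Feller property and quasilocality of the perturbed kernels, rb-p1/ds-3), then `isGibbsMeasure_of_cylinderDLR`.
Also: the periodised family is nonempty-limit (`perturbedLimitPoints_nonempty`, rb-p2) so the member HAS a DLR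
state arising as a torus limit. WHAT THIS IS NOT: no row, no number; the torus-ball membership of the family
and the identification sentences are the next file; nothing about the continuum or the Clay Millennium problem.

References: H.-O. Georgii (2011), Thm. 4.17, (2.15), Rem. 1.24; S. Friedli, Y. Velenik (2017), Thm. 6.26,
Lemma 6.7, remark before Ex. 6.14 (periodic boundary conditions); E. Seiler, LNP 159 (1982) Ch. 2; the tree's
`LatticeGaugeDLRGibbsProofs.lean`; ds-2 `StarChartMember.lean`, `StarChartKernel.lean`; rb-p2
`PerturbedLimitStates.lean`; rb-p1 `PerturbedSpecification.lean`, `PerturbedExistence.lean`; ds-3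
`PerturbedCollar.lean`, `PeriodisedBox.lean`, `GibbsOfCylinderDLR.lean`.
-/

noncomputable section

open MeasureTheory Filter Topology Function Finset
open Literature.Probability.LatticeModels
open Literature.MathematicalPhysics.QuantumLattice hiding torusNorm
open Literature.MathematicalPhysics.QuantumFieldTheory hiding ZdEdge Site
open Literature.MathematicalPhysics.QuantumFieldTheory.Balaban1983to89.StrongCouplingTorusWindow (specAvg)

namespace Summit.Ventures.YMGap.RobustBall

variable {d N : ℕ}

/-! ### The periodised family -/

section Family

variable (W : Potential (ZdEdge d) (SUN N)) (supp : Finset (ZdEdge d) → Finset (Finset (ZdEdge d)))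
  (hdep : ∀ X, DependsOn (W X) (↑X : Set (ZdEdge d))) (hg : ∀ X, IsZdGaugeInvariant (W X))
  (hm : ∀ X, Measurable (W X)) (hb : ∀ X, ∃ C, ∀ U, |W X U| ≤ C)

/-- **THE PERIODISED FAMILY of the member `(W, supp)`**: on the torus of side `L + 1`, the chart member
(ds-2's `chartMember`) of the BOX FAMILY `boxFamily W supp (L / 2)` — the member's active listed interaction
sets all of whose links are based in the centred box of radius `L / 2`, read through the periodic lift. A
`PerturbationFamily d N` in the sense of rb-p2's `PerturbedLimitStates.lean`. [folklore] -/
def periodisedFamily : PerturbationFamily d N :=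
  fun L => chartMember (L + 1) (boxFamily W supp (L / 2)) W hdep hg hm hb

/-- The periodised family, unfolded. [folklore] -/
@[simp] theorem periodisedFamily_apply (L : ℕ) :
    periodisedFamily W supp hdep hg hm hb L = chartMember (L + 1) (boxFamily W supp (L / 2)) W hdep hg hm hb := rfl

end Family

/-! ### Fixed torus: the perturbed torus state satisfies the member's `ℤ^d` DLR equation in `Λ` -/

section FixedTorus

variable {L : ℕ} [NeZero L] {W : Potential (ZdEdge d) (SUN N)}
  {supp : Finset (ZdEdge d) → Finset (Finset (ZdEdge d))}
  (hdep : ∀ X, DependsOn (W X) (↑X : Set (ZdEdge d))) (hg : ∀ X, IsZdGaugeInvariant (W X))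
  (hm : ∀ X, Measurable (W X)) (hb : ∀ X, ∃ C, ∀ U, |W X U| ≤ C)

/-- **The kernels of the box member and of the active-family member of `Λ` coincide on the projected volume.**
If the active family of `Λ` is inside the box family of radius `n`, `2n < L`, and the base sites of `Λ` lie in the
box, then for every torus configuration `V` the `Λ.image (torusEdge L)`-kernels of the chart members of the two
families agree: the extra box sets miss `Λ` (`disjoint_of_mem_boxFamily_of_not_mem_activeFamily`) and `mod L` is
injective on the box, so their lifted terms do not feel the resampled links. [folklore] -/
theorem perturbedTorusSpec_boxFamily_eq_activeFamily (hsupp : W.IsSupportedBy supp) {n : ℕ} (hn : 2 * n < L)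
    (β : ℝ) {Λ : Finset (ZdEdge d)} (hact : activeFamily W supp Λ ⊆ boxFamily W supp n)
    (hΛ : Λ.image Prod.fst ⊆ siteBox d n) (V : GaugeConfig d L (SUN N)) :
    perturbedTorusSpec (chartMember L (boxFamily W supp n) W hdep hg hm hb) β (Λ.image (torusEdge L)) V =
      perturbedTorusSpec (chartMember L (activeFamily W supp Λ) W hdep hg hm hb) β (Λ.image (torusEdge L)) V := by
  classical
  have hinj : Set.InjOn (Torus.proj L) (siteBox d n : Set (Site d)) := injOn_proj_siteBox hn
  refine perturbedTorusSpec_eq_of_total_sub _ _ β _ V fun ζ => ?_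
  simp only [total_chartMember]
  rw [← Finset.sum_sdiff hact, ← Finset.sum_sdiff hact, add_sub_cancel_right, add_sub_cancel_right]
  refine Finset.sum_congr rfl fun X hX => ?_
  obtain ⟨hXbox, hXact⟩ := Finset.mem_sdiff.1 hX
  have hdisj := disjoint_of_mem_boxFamily_of_not_mem_activeFamily hsupp hXbox hXact
  refine hdep X fun e he => ?_
  have heX : e ∈ X := Finset.mem_coe.1 he
  -- the projected link of `e ∈ X` is not a resampled link
  have hnot : torusEdge L e ∉ Λ.image (torusEdge L) := by
    intro hmem
    obtain ⟨e', he'Λ, hee'⟩ := Finset.mem_image.1 hmem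
    have hTinj : Set.InjOn (torusEdge (d := d) L) ↑(X ∪ Λ) := by
      refine injOn_torusEdge (hinj.mono fun v hv => ?_)
      obtain ⟨f, hf, rfl⟩ := Finset.mem_image.1 (Finset.mem_coe.1 hv)
      rcases Finset.mem_union.1 hf with hfX | hfΛ
      · exact Finset.mem_coe.2 (base_mem_siteBox_of_mem_boxFamily hXbox hfX)
      · exact Finset.mem_coe.2 (hΛ (Finset.mem_image_of_mem _ hfΛ))
    have hEq : e' = e := hTinj (Finset.mem_coe.2 (Finset.mem_union_right _ he'Λ))
      (Finset.mem_coe.2 (Finset.mem_union_left _ heX)) hee'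
    exact Finset.disjoint_left.1 hdisj heX (hEq ▸ he'Λ)
  show (glueWith (Λ.image (torusEdge L)) ζ V) (torusEdge L e) = V (torusEdge L e)
  simp [glueWith, hnot]

/-- **Fixed torus: the perturbed torus state of the box member satisfies the member's `ℤ^d` DLR equation in `Λ`
on lifted observables.** Let `F` be a bounded continuous cylinder observable with support `S₀`, `2n < L`, the
active family of `Λ` inside the box family of radius `n`, and the base sites of `Λ`, of `S₀`, of the `W`-collar and
of the plaquette collar of `Λ` inside the box. Then
`⟨F ∘ torusLift⟩ = ⟨(γ^{W,β}_Λ F) ∘ torusLift⟩` under the perturbed torus state of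
`chartMember L (boxFamily W supp n) W` (torus DLR, kernel comparison, ds-2's perturbed kernel transfer). [folklore] -/
theorem expectation_boxMember_dlr (hsupp : W.IsSupportedBy supp) {n : ℕ} (hn : 2 * n < L) (β : ℝ) (Λ : Finset (ZdEdge d)) {F : LGConfig d (SUN N) → ℝ} (hF : Continuous F)
    {C : ℝ} (hC : ∀ U, |F U| ≤ C) {S₀ : Finset (ZdEdge d)} (hFS : IsCylinder F S₀)
    (hact : activeFamily W supp Λ ⊆ boxFamily W supp n)
    (hbig : (Λ ∪ (S₀ ∪ (Λ ∪ Λ.biUnion (perturbedNbr supp))) ∪ (plaquettesTouching Λ).biUnion plaquetteEdges).image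
        Prod.fst ⊆ siteBox d n) :
    (chartMember L (boxFamily W supp n) W hdep hg hm hb).expectation (fundamentalRep (Fin N)) β
        (toTorusObservable L F) =
      (chartMember L (boxFamily W supp n) W hdep hg hm hb).expectation (fundamentalRep (Fin N)) β
        (toTorusObservable L fun η => ∫ U, F U ∂(perturbedYM (d := d) (fundamentalRep (Fin N)) β W supp Λ η)) := by
  classical
  set W' := chartMember L (boxFamily W supp n) W hdep hg hm hb with hW'
  haveI := isProbabilityMeasure_perturbedMeasure W' β
  have hGibbs := isGibbsMeasure_perturbedMeasure W' β
  have hspec := isSpecification_perturbedTorusSpec W' β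
  have hinj : Set.InjOn (Torus.proj L) (siteBox d n : Set (Site d)) := injOn_proj_siteBox hn
  have hL := hinj.mono (Finset.coe_subset.2 hbig)
  have hΛ : Λ.image Prod.fst ⊆ siteBox d n := fun v hv => by
    obtain ⟨e, he, rfl⟩ := Finset.mem_image.1 hv
    exact hbig (Finset.mem_image_of_mem _ (Finset.mem_union_left _ (Finset.mem_union_left _ he)))
  have hS : ∀ X, X ∈ activeFamily W supp Λ ↔ X ∈ supp Λ ∧ (X ∩ Λ).Nonempty ∧ W X ≠ 0 :=
    fun X => mem_activeFamily
  -- the lifted observable is integrable for the torus state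
  have hFt : Measurable (toTorusObservable L F) := hF.measurable.comp (continuous_torusLift L).measurable
  have hint : Integrable (toTorusObservable L F) (W'.perturbedMeasure (fundamentalRep (Fin N)) β) :=
    integrable_of_bound hFt.aestronglyMeasurable (C := C) fun V => hC _
  unfold QuasiLocalGaugePerturbation.expectation
  rw [← hGibbs.integral_integral_eq hspec (Λ.image (torusEdge L)) hint]
  refine integral_congr_ae (ae_of_all _ fun V => ?_)
  show ∫ σ, toTorusObservable L F σ ∂(perturbedTorusSpec W' β (Λ.image (torusEdge L)) V) =
    toTorusObservable L (fun η => ∫ U, F U ∂(perturbedYM (d := d) (fundamentalRep (Fin N)) β W supp Λ η)) V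
  rw [toTorusObservable_apply, hW', perturbedTorusSpec_boxFamily_eq_activeFamily hdep hg hm hb hsupp hn β hact hΛ V,
    integral_perturbedYM_torusLift_eq hdep hg hm hb hsupp Λ hS hF.measurable hFS hL V]

end FixedTorus

/-! ### Infinite volume: limit states of the periodised family are DLR states of the member -/

section Limit

variable {W : Potential (ZdEdge d) (SUN N)} {supp : Finset (ZdEdge d) → Finset (Finset (ZdEdge d))}
  (hdep : ∀ X, DependsOn (W X) (↑X : Set (ZdEdge d))) (hg : ∀ X, IsZdGaugeInvariant (W X))
  (hm : ∀ X, Measurable (W X)) (hb : ∀ X, ∃ C, ∀ U, |W X U| ≤ C)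

/-- ★ **EVERY INFINITE-VOLUME LIMIT STATE OF THE PERIODISED TORUS STATES IS A DLR STATE OF THE MEMBER.**
Let `(W, supp)` be a link potential on `ℤ^d` with continuous gauge-invariant terms reading their own links,
locally finitely supported (`Potential.IsSupportedBy`) with range `R` (listed sets through a link stay within
`ℓ^∞`-distance `R` of it). Then every `μ ∈ perturbedLimitPoints β (periodisedFamily W supp …)` — every weak limit,
along torus sizes `L_k + 1 → ∞`, of the perturbed torus states of the periodised family, tested on bounded
continuous cylinder observables — is a Gibbs measure of the member's perturbed `ℤ^d` specification:
`μ ∈ perturbedGibbsMeasures (fundamentalRep (Fin N)) β W supp`. (Georgii 2011, Thm. 4.17 for periodic boundary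
conditions and a finite-range perturbation of the Wilson action.) [folklore] -/
theorem mem_perturbedGibbsMeasures_of_mem_perturbedLimitPoints (hsupp : W.IsSupportedBy supp)
    (hWc : ∀ X, Continuous (W X)) {R : ℝ} (hrange : ∀ e, ∀ X ∈ supp {e}, e ∈ X → ∀ y ∈ X, ‖e.1 - y.1‖ ≤ R)
    (β : ℝ) {μ : Measure (LGConfig d (SUN N))}
    (hμ : μ ∈ perturbedLimitPoints β (periodisedFamily W supp hdep hg hm hb)) :
    μ ∈ perturbedGibbsMeasures (d := d) (fundamentalRep (Fin N)) β W supp := by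
  classical
  haveI : SecondCountableTopology (Matrix (Fin N) (Fin N) ℂ) :=
    inferInstanceAs (SecondCountableTopology (Fin N → Fin N → ℂ))
  haveI : SecondCountableTopology (SUN N) := Topology.IsEmbedding.subtypeVal.secondCountableTopology
  obtain ⟨Ls, hLs, hprob, hlim⟩ := hμ
  haveI := hprob
  have hρ : Continuous (fundamentalRep (Fin N)) := continuous_fundamentalRep (Fin N)
  have hW : W.IsAdapted := fun X => ⟨hdep X, hm X⟩
  have hspecZ : IsSpecification (perturbedYM (d := d) (fundamentalRep (Fin N)) β W supp) :=
    isSpecification_perturbedYM _ hρ β hW hb hsupp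
  refine isGibbsMeasure_of_cylinderDLR hspecZ
    (fun Λ F hF C hC => continuous_integral_perturbedYM _ hρ β hWc supp Λ hF hC) fun Λ F S₀ hFS hFc C hC => ?_
  -- kernel averages are bounded by `C` and are cylinder observables on the `W`-collar
  haveI hγprob : ∀ η, IsProbabilityMeasure (perturbedYM (d := d) (fundamentalRep (Fin N)) β W supp Λ η) :=
    fun η => isProbabilityMeasure_perturbedYM _ hρ β hm hb supp Λ η
  have hbound : ∀ η, |∫ U, F U ∂(perturbedYM (d := d) (fundamentalRep (Fin N)) β W supp Λ η)| ≤ C := fun η => by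
    have h := norm_integral_le_of_norm_le_const (μ := perturbedYM (d := d) (fundamentalRep (Fin N)) β W supp Λ η)
      (f := F) (C := C) (ae_of_all _ fun U => by simpa [Real.norm_eq_abs] using hC U)
    simpa [Real.norm_eq_abs] using h
  have hcylγ : IsCylinder (fun η => ∫ U, F U ∂(perturbedYM (d := d) (fundamentalRep (Fin N)) β W supp Λ η))
      (S₀ ∪ (Λ ∪ Λ.biUnion (perturbedNbr supp))) :=
    dependsOn_specAvg_perturbedYM _ hρ β hm hdep hsupp Λ hFc.measurable hFS
  -- the two torus expectation sequences converge to the two sides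
  have h1 := hlim F S₀ hFS hFc ⟨C, hC⟩
  have h2 := hlim (fun η => ∫ U, F U ∂(perturbedYM (d := d) (fundamentalRep (Fin N)) β W supp Λ η))
    (S₀ ∪ (Λ ∪ Λ.biUnion (perturbedNbr supp))) hcylγ
    (continuous_integral_perturbedYM _ hρ β hWc supp Λ hFc hC) ⟨C, hbound⟩
  -- and agree for all large `k`
  have hk : Tendsto Ls atTop atTop := hLs.tendsto_atTop
  have hA := hk.eventually (eventually_activeFamily_subset_boxFamily hsupp hrange Λ)
  have hB := hk.eventually (eventually_subset_siteBox
    ((Λ ∪ (S₀ ∪ (Λ ∪ Λ.biUnion (perturbedNbr supp))) ∪ (plaquettesTouching Λ).biUnion plaquetteEdges).image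
      Prod.fst))
  have hev : ∀ᶠ k in atTop,
      (periodisedFamily W supp hdep hg hm hb (Ls k)).expectation (fundamentalRep (Fin N)) β
          (toTorusObservable (Ls k + 1) F) =
        (periodisedFamily W supp hdep hg hm hb (Ls k)).expectation (fundamentalRep (Fin N)) β
          (toTorusObservable (Ls k + 1) fun η =>
            ∫ U, F U ∂(perturbedYM (d := d) (fundamentalRep (Fin N)) β W supp Λ η)) := by
    filter_upwards [hA, hB] with k hkA hkB
    exact expectation_boxMember_dlr hdep hg hm hb hsupp (L := Ls k + 1) (n := Ls k / 2) (by omega) β Λ hFc hC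
      hFS hkA hkB
  exact tendsto_nhds_unique (h1.congr' hev) h2

/-- **The member has a DLR state which is a torus limit**: the periodised family has infinite-volume limit states
(rb-p2's `perturbedLimitPoints_nonempty`, compactness), and each is a DLR state of the member. [folklore] -/
theorem exists_mem_perturbedLimitPoints_mem_perturbedGibbsMeasures (hsupp : W.IsSupportedBy supp)
    (hWc : ∀ X, Continuous (W X)) {R : ℝ} (hrange : ∀ e, ∀ X ∈ supp {e}, e ∈ X → ∀ y ∈ X, ‖e.1 - y.1‖ ≤ R)
    (β : ℝ) :
    ∃ μ ∈ perturbedLimitPoints β (periodisedFamily W supp hdep hg hm hb),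
      μ ∈ perturbedGibbsMeasures (d := d) (fundamentalRep (Fin N)) β W supp := by
  obtain ⟨μ, hμ⟩ := perturbedLimitPoints_nonempty β (periodisedFamily W supp hdep hg hm hb)
  exact ⟨μ, hμ, mem_perturbedGibbsMeasures_of_mem_perturbedLimitPoints hdep hg hm hb hsupp hWc hrange β hμ⟩

/-- ★ **UNIQUENESS REGIME: every torus limit state IS the DLR state.** If the member's `ℤ^d` specification has a
unique Gibbs measure, then every infinite-volume limit state of the periodised family's torus states equals every
DLR state of the member — ONE state. [folklore] -/
theorem eq_of_mem_perturbedLimitPoints_of_hasUniqueGibbsMeasure (hsupp : W.IsSupportedBy supp)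
    (hWc : ∀ X, Continuous (W X)) {R : ℝ} (hrange : ∀ e, ∀ X ∈ supp {e}, e ∈ X → ∀ y ∈ X, ‖e.1 - y.1‖ ≤ R)
    (β : ℝ) (huniq : HasUniqueGibbsMeasure (perturbedYM (d := d) (fundamentalRep (Fin N)) β W supp))
    {μ ν : Measure (LGConfig d (SUN N))} (hμ : μ ∈ perturbedLimitPoints β (periodisedFamily W supp hdep hg hm hb))
    (hν : ν ∈ perturbedGibbsMeasures (d := d) (fundamentalRep (Fin N)) β W supp) : μ = ν :=
  huniq.1 (mem_perturbedGibbsMeasures_of_mem_perturbedLimitPoints hdep hg hm hb hsupp hWc hrange β hμ) hν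

end Limit

end Summit.Ventures.YMGap.RobustBall

end
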